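import Mathlib
import Literature.MathematicalPhysics.QuantumLattice.WilsonCellSchur
import Literature.MathematicalPhysics.QuantumFieldTheory.WilsonFlow

/-!
# Sketch — crux-ideate round 1, ideator 3, crux `EarlyCrosserLaw` (stmt-QuantumFields-13995)

First lemmas of the three idea cards (statements only; they must elaborate, proofs are for provers):

* `TwoPointLawOfMotion`, `DefiniteModeDisplacement` — card `flow-the-links-carry-the-crossing`;
* `ShadowPencil` — card `fragile-crossers-are-molecules`;
* `ZeroExtensionLeakage`, `FaceCommutatorFree` — card `cells-inherit-torus-extinction`.
-/

noncomputable section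

open scoped Matrix BigOperators ComplexConjugate
open Literature.MathematicalPhysics.QuantumLattice Literature.MathematicalPhysics.QuantumFieldTheory
  Literature.Probability.LatticeModels

namespace Summit.QuantumFields.QCD.Cruxes.EarlyCrosserLaw.Ideator3

/-- Local notation: the colour group `SU(3)`. -/
local notation "𝔾" => Matrix.specialUnitaryGroup (Fin 3) ℂ

/-- **Two-point law of motion (exact, integrated Hellmann–Feynman identity).** For two gauge fields
`U₀, U₁` on the same torus and the same open box, if `w₀` is a real eigenvector of the massless
Dirichlet Wilson cell of `U₀` (eigenvalue `l₀`) and `w₁` one of `U₁` (eigenvalue `l₁`), then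
`(l₁ − l₀) ⟨w₀, Γ₅ w₁⟩ = ⟨w₀, Γ₅ (D_c[U₁] − D_c[U₀]) w₁⟩` — because `Γ₅ w₀` is a LEFT eigenvector of
`D_c[U₀]` (γ₅-hermiticity passes to principal submatrices, `Γ₅` being site/colour diagonal). Its
infinitesimal form is the route's law of motion `λ' = ⟨w, Γ₅ D' w⟩/⟨w, Γ₅ w⟩`; this two-point form is
what the card integrates along the gradient flow of the links. -/
def TwoPointLawOfMotion : Prop :=
  ∀ (N : ℕ) [NeZero N] (U₀ U₁ : GaugeConfig 4 N 𝔾) (x : TorusSite 4 N) (s : Fin 4 → ℕ)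
    (l₀ l₁ : ℝ) (w₀ w₁ : {p // wilsonBox x s p} → ℂ),
    (wilsonCell U₀ 0 x s).mulVec w₀ = (l₀ : ℂ) • w₀ →
    (wilsonCell U₁ 0 x s).mulVec w₁ = (l₁ : ℂ) • w₁ →
    ((l₁ : ℂ) - (l₀ : ℂ)) * ∑ p, star (w₀ p) * gammaFive p.1.2.2 p.1.2.2 * w₁ p =
      ∑ p, star (w₀ p) * gammaFive p.1.2.2 p.1.2.2 *
        ((wilsonCell U₁ 0 x s - wilsonCell U₀ 0 x s).mulVec w₁) p

/-- **Displacement of a mode with chiral overlap** (Cauchy–Schwarz on `TwoPointLawOfMotion`): the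
real eigenvalue can move between `U₀` and `U₁` by at most
`‖w₀‖ · ‖(D_c[U₁] − D_c[U₀]) w₁‖ / |⟨w₀, Γ₅ w₁⟩|` — only the action of the perturbation ON THE MODE
enters, weighted by the inverse chiral overlap (definite Krein type ⇒ overlap bounded below along a
continuous deformation, GLR Thm 9.3.1). -/
def DefiniteModeDisplacement : Prop :=
  ∀ (N : ℕ) [NeZero N] (U₀ U₁ : GaugeConfig 4 N 𝔾) (x : TorusSite 4 N) (s : Fin 4 → ℕ)
    (l₀ l₁ : ℝ) (w₀ w₁ : {p // wilsonBox x s p} → ℂ),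
    (wilsonCell U₀ 0 x s).mulVec w₀ = (l₀ : ℂ) • w₀ →
    (wilsonCell U₁ 0 x s).mulVec w₁ = (l₁ : ℂ) • w₁ →
    |l₁ - l₀| * ‖∑ p, star (w₀ p) * gammaFive p.1.2.2 p.1.2.2 * w₁ p‖ ≤
      Real.sqrt (∑ p, ‖w₀ p‖ ^ 2) *
        Real.sqrt (∑ p, ‖((wilsonCell U₁ 0 x s - wilsonCell U₀ 0 x s).mulVec w₁) p‖ ^ 2)

/-- **The Γ₅-shadow pencil of a crossing (exact 2×2 identities).** Let the Hermitian Wilson cell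
operator `H(μ) = Γ₅ · wilsonCell U μ x s` have a zero mode `w` at `μ₀` (a crossing), `‖w‖ = 1`,
chirality `χ = ⟨w, Γ₅ w⟩` (real), and let `u = Γ₅ w − χ w` be its *shadow* (`‖u‖² = 1 − χ²`,
`u ⊥ w`). Then on the plane `span{w, u}` (which `Γ₅` preserves): (i) the shadow carries the
OPPOSITE chirality, `⟨u, Γ₅ u⟩ = −χ (1 − χ²)`; (ii) the pencil couples `w` to its shadow linearly in
the mass, `⟨u, H(μ₀ + t) w⟩ = t (1 − χ²)`; (iii) the Gram determinant of `H(μ₀ + t)` on `{w, u}` is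
`t · (χ ⟨u, H(μ₀) u⟩ − t (1 − χ²))`: besides `t = 0` it vanishes at the *partner mass*
`t⋆ = χ ⟨u, H(μ₀) u⟩ / (1 − χ²)`. A fragile crossing (small `χ`) thus forces a second zero of the
compressed pencil at mass distance `O(χ)`, of opposite Krein sign (GLR Cor. 9.1.2: real eigenvalues
leave the axis only in (+,−) pairs). -/
def ShadowPencil : Prop :=
  ∀ (N : ℕ) [NeZero N] (U : GaugeConfig 4 N 𝔾) (x : TorusSite 4 N) (s : Fin 4 → ℕ) (μ₀ t : ℝ)
    (w : {p // wilsonBox x s p} → ℂ),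
    (wilsonCell U μ₀ x s).mulVec w = 0 →
    (∑ p, star (w p) * w p) = 1 →
    let g5 : {p // wilsonBox x s p} → ℂ := fun p => gammaFive p.1.2.2 p.1.2.2
    let χ : ℂ := ∑ p, star (w p) * g5 p * w p
    let u : {p // wilsonBox x s p} → ℂ := fun p => g5 p * w p - χ * w p
    let H : ℝ → ({p // wilsonBox x s p} → ℂ) → ({p // wilsonBox x s p} → ℂ) :=
      fun μ v p => g5 p * (wilsonCell U μ x s).mulVec v p
    let ip : ({p // wilsonBox x s p} → ℂ) → ({p // wilsonBox x s p} → ℂ) → ℂ :=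
      fun a b => ∑ p, star (a p) * b p
    ip u (fun p => g5 p * u p) = -χ * (1 - χ ^ 2) ∧
    ip u (H (μ₀ + t) w) = (t : ℂ) * (1 - χ ^ 2) ∧
    ip w (H (μ₀ + t) w) * ip u (H (μ₀ + t) u) - ip w (H (μ₀ + t) u) * ip u (H (μ₀ + t) w) =
      (t : ℂ) * (χ * ip u (H μ₀ u) - (t : ℂ) * (1 - χ ^ 2))

/-- **Zero-extension leakage (cell eigenvectors are torus quasimodes with face-supported defect).**
Extend a box vector `w` by zero to the torus. Then the torus Wilson–Dirac operator agrees with the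
Dirichlet cell INSIDE the box, and what leaks OUTSIDE is supported on the one-site collar and bounded
by the mass of `w` on the first/last interior layers (each leak is a `½(1 ∓ γ_μ)`-projected, unitarily
transported face value; `64` is a crude counting constant). Consequence used by the card: a real
cell eigenvector with small face mass is an `O(face mass)`-quasimode of the HERMITIAN torus operator
`Γ₅(D_W − λ)`, hence (Hermitian!) a torus near-crossing. -/
def ZeroExtensionLeakage : Prop :=
  ∀ (N : ℕ) [NeZero N] (U : GaugeConfig 4 N 𝔾) (μ : ℝ) (x : TorusSite 4 N) (s : Fin 4 → ℕ)
    (w : {p // wilsonBox x s p} → ℂ),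
    let wt : TorusSite 4 N × Fin 3 × Fin 4 → ℂ := fun p => if h : wilsonBox x s p then w ⟨p, h⟩ else 0
    let Dw : TorusSite 4 N × Fin 3 × Fin 4 → ℂ := (wilsonDirac (fundamentalRep (Fin 3)) U μ 1).mulVec wt
    (∀ (p : TorusSite 4 N × Fin 3 × Fin 4) (h : wilsonBox x s p),
        Dw p = (wilsonCell U μ x s).mulVec w ⟨p, h⟩) ∧
    (∑ p, (if wilsonBox x s p then (0 : ℝ) else ‖Dw p‖ ^ 2)) ≤
      64 * ∑ q : {p // wilsonBox x s p},
        (if (∃ i, (q.1.1 i - x i).val = 1 ∨ (q.1.1 i - x i).val + 1 = s i) then ‖w q‖ ^ 2 else 0)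

/-- **The universal face commutator (free links).** For the identity gauge field the Hermitian part
`W_c = ½(M + Mᴴ)` and the anti-Hermitian part `N_c = ½(M − Mᴴ)` of the Dirichlet Wilson cell
`M = wilsonCell 1 μ x s` commute up to a FACE term only:
`[W_c, N_c] = ½ Σ_μ Γ_μ (E^μ_first − E^μ_last)`, `E^μ_first/last` the projectors onto the first /
last interior layer in direction `μ` (one-dimensional computation `[1 − ½(S+Sᵀ), ½(S−Sᵀ)] =
½(SSᵀ − SᵀS) = ½(E₁ − E_n)` for the truncated shift `S`; hops in different directions act on
different tensor factors of the product box). For a general field the same face term appears plus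
interior plaquette commutators; it is the `U`-INDEPENDENT, `γ_μ`-polarised source term in
`D_c†D_c − W_c² = N_c†N_c + [W_c, N_c]`, i.e. the only way a curvature-free region can power a real
mode is through a Kaplan-type wall state on a face. -/
def FaceCommutatorFree : Prop :=
  ∀ (N : ℕ) [NeZero N] (μ : ℝ) (x : TorusSite 4 N) (s : Fin 4 → ℕ), (∀ i, s i ≤ N) →
    let M : Matrix {p // wilsonBox x s p} {p // wilsonBox x s p} ℂ :=
      wilsonCell (fun _ => (1 : 𝔾)) μ x s
    let Wc := (1 / 2 : ℂ) • (M + Mᴴ)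
    let Nc := (1 / 2 : ℂ) • (M - Mᴴ)
    let Γ : Fin 4 → Matrix {p // wilsonBox x s p} {p // wilsonBox x s p} ℂ := fun i =>
      Matrix.of fun p q =>
        if p.1.1 = q.1.1 ∧ p.1.2.1 = q.1.2.1 then euclideanGamma i p.1.2.2 q.1.2.2 else 0
    let Efirst : Fin 4 → Matrix {p // wilsonBox x s p} {p // wilsonBox x s p} ℂ := fun i =>
      Matrix.diagonal fun p => if (p.1.1 i - x i).val = 1 then 1 else 0
    let Elast : Fin 4 → Matrix {p // wilsonBox x s p} {p // wilsonBox x s p} ℂ := fun i =>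
      Matrix.diagonal fun p => if (p.1.1 i - x i).val + 1 = s i then 1 else 0
    Wc * Nc - Nc * Wc = (1 / 2 : ℂ) • ∑ i, Γ i * (Efirst i - Elast i)

/-- **Transport along the Wilson flow (the card's path).** `TwoPointLawOfMotion` specialised to the pair
`(U, wilsonFlow t U)` (tree `Literature.MathematicalPhysics.QuantumFieldTheory.wilsonFlow`, Lüscher's lattice
gradient flow, flow time in lattice units): a real eigenvalue tracked from the rough field `U` to its flowed
image moves by exactly the `Γ₅`-paired matrix element of the CHANGE OF THE CELL OPERATOR between the two
fields, divided by the chiral overlap. Differentiating in `t` gives `λ̇_t = ⟨w_t, Γ₅ Ḋ_t w_t⟩/⟨w_t, Γ₅ w_t⟩`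
with `Ḋ_t` built from the LOCAL flow force `−P(Ω_{x,μ}(V_t)) V_t(x,μ)` (`wilsonFlowVF`). -/
def FlowTwoPoint : Prop :=
  ∀ (N : ℕ) [NeZero N] (U : GaugeConfig 4 N 𝔾) (t : ℝ) (x : TorusSite 4 N) (s : Fin 4 → ℕ)
    (l₀ l₁ : ℝ) (w₀ w₁ : {p // wilsonBox x s p} → ℂ),
    (wilsonCell U 0 x s).mulVec w₀ = (l₀ : ℂ) • w₀ →
    (wilsonCell (wilsonFlow t U) 0 x s).mulVec w₁ = (l₁ : ℂ) • w₁ →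
    ((l₁ : ℂ) - (l₀ : ℂ)) * ∑ p, star (w₀ p) * gammaFive p.1.2.2 p.1.2.2 * w₁ p =
      ∑ p, star (w₀ p) * gammaFive p.1.2.2 p.1.2.2 *
        ((wilsonCell (wilsonFlow t U) 0 x s - wilsonCell U 0 x s).mulVec w₁) p

end Summit.QuantumFields.QCD.Cruxes.EarlyCrosserLaw.Ideator3

end
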